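import Mathlib
import Summits.Ventures.PercRepro2.Defs
import Summits.Ventures.PercRepro2.Independence
import Summits.Ventures.PercRepro2.Harris
import Summits.Ventures.PercRepro2.ZCTwoEdge
import Summits.Ventures.PercRepro2.ZCOA3WCert
import Summits.Ventures.PercRepro2.ZCA3WTypes
import Summits.Ventures.PercRepro2.ZCOA3WCells

/-!
# Theorem I (MINE-A.md §74.5), abstract form — (ZC) when `o` has degree two with neighbours `a₃`
and a non-mark `w` (the first MIRROR placement of §70.8), from (ZC) on `G − o` for the marks
`(a₁, a₃, w)` and BHK06 avoidance (blind cell PercRepro2, mine-a g25)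

Abstract setting: two distinct edges `f₁` (`o a₃`, weight `p f₁`), `f₂` (`o w`, weight `p f₂`) and
seven events of the configuration space that ignore `f₁`, `f₂` — in the graph instance
(`ZCOA3WGraph.lean`) the events of `G − o`: `A = {a₁ ↔ a₃}`, `W = {a₁ ↔ w}`, `Γ = {a₃ ↔ w}`,
`X₀ = {C(a₁) ∈ 𝒰}`, `X₁ = {C(a₁) ∪ {o} ∈ 𝒰}`, `X₂ = {C(a₁) ∪ C(w) ∪ {o} ∈ 𝒰}`,
`X₃ = {C(a₁) ∪ C(a₃) ∪ {o} ∈ 𝒰}`, `X₄ = {C(a₁) ∪ C(a₃) ∪ C(w) ∪ {o} ∈ 𝒰}`.  The five types of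
`(a₁, a₃, w)` are `T₁ = A ∩ W`, `T₂ = A ∩ Wᶜ`, `T₃ = Aᶜ ∩ W`, `T₄ = Aᶜ ∩ Wᶜ ∩ Γ`, `T₅ = Aᶜ ∩ Wᶜ ∩ Γᶜ`
(`ZCA3WTypes`), and the (ZC) events are `e = A ∪ ({f₁, f₂} ∩ W)`, `L = ({f₁} ∩ A) ∪ ({f₂} ∩ W)`,
`γ = {f₁} ∪ ({f₂} ∩ Γ)`, `U` as in `ZCOA3WCells`.

**Theorem** (`zc_oa3w`): with the seven events increasing, the transitivity relation `A ∩ Γ ⊆ W`, the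
inclusions `X₀ ⊆ X₁ ⊆ X₂ ⊆ X₄`, `X₁ ⊆ X₃`, the coincidences `X₃ ∩ A = X₁ ∩ A`, `X₄ ∩ A = X₂ ∩ A`,
`X₂ ∩ W = X₁ ∩ W`, `X₄ ∩ W = X₃ ∩ W`, `X₂ ∩ Γ = X₃ ∩ Γ`, `X₄ ∩ Γ = X₂ ∩ Γ`, lemma (P1) with `a₃`
in the middle, the inductive hypotheses `(ZC)(A, W, Γ; X₀) ≥ 0` and `(ZC)(A, W, Γ; X₁) ≥ 0` (= (ZC)
on `G − o` for the marks `(a₁, a₃, w)`, the up-set and the up-set shifted by `o`) and the three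
BHK06-avoidance inequalities `P(Xₖ ∩ T₄) · P(S) ≤ P(Xₖ ∩ S) · P(T₄)` for `S = Aᶜ` (`k = 0`) and
`S = Aᶜ ∩ Wᶜ` (`k = 0, 1`) (`bhk_inside_outside_avoid`: given that the root cluster avoids `S`, its
up-set event and the outside connection `a₃ ↔ w` are negatively correlated), (ZC)
`P(D) Cov(U, eL) − P(B) Cov(U, e¬L) ≥ 0`.  Proof: the cell expansions, the type bookkeeping and the
kernel certificate `zc_oa3w_cert` (199 terms, kit j278601).  One seat.
-/

namespace Summit.Ventures.PercRepro2

section TypeSplitI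

variable {E : Type*} [Fintype E] [DecidableEq E] {R : Type*} [CommRing R]
  (p : E → R) {A W Γ : Set (Config E)}

/-- `P(Y ∩ (W ∪ Γ))` in type masses, when `A ∩ Γ ⊆ W`. -/
lemma prob_inter_union_WΓ (hAΓ : ∀ ω, ω ∈ A → ω ∈ Γ → ω ∈ W) (Y : Set (Config E)) :
    prob p (Y ∩ (W ∪ Γ)) = prob p (Y ∩ (A ∩ W)) + prob p (Y ∩ (Aᶜ ∩ W)) + prob p (Y ∩ (Aᶜ ∩ Wᶜ ∩ Γ)) := by
  rw [prob_eq_sum_five p A W Γ (Y ∩ (W ∪ Γ))]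
  have e1 : Y ∩ (W ∪ Γ) ∩ (A ∩ W) = Y ∩ (A ∩ W) := by
    ext ω; simp only [Set.mem_inter_iff, Set.mem_union]; tauto
  have e2 : Y ∩ (W ∪ Γ) ∩ (A ∩ Wᶜ) = ∅ := by
    ext ω; have := hAΓ ω
    simp only [Set.mem_inter_iff, Set.mem_union, Set.mem_compl_iff, Set.mem_empty_iff_false]; tauto
  have e3 : Y ∩ (W ∪ Γ) ∩ (Aᶜ ∩ W) = Y ∩ (Aᶜ ∩ W) := by
    ext ω; simp only [Set.mem_inter_iff, Set.mem_union, Set.mem_compl_iff]; tauto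
  have e4 : Y ∩ (W ∪ Γ) ∩ (Aᶜ ∩ Wᶜ ∩ Γ) = Y ∩ (Aᶜ ∩ Wᶜ ∩ Γ) := by
    ext ω; simp only [Set.mem_inter_iff, Set.mem_union, Set.mem_compl_iff]; tauto
  have e5 : Y ∩ (W ∪ Γ) ∩ (Aᶜ ∩ Wᶜ ∩ Γᶜ) = ∅ := by
    ext ω; simp only [Set.mem_inter_iff, Set.mem_union, Set.mem_compl_iff, Set.mem_empty_iff_false]; tauto
  rw [e1, e2, e3, e4, e5, prob_empty]; ring

/-- `P(Y ∩ (Aᶜ ∩ Wᶜ))` in type masses. -/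
lemma prob_inter_AcWc (Y : Set (Config E)) :
    prob p (Y ∩ (Aᶜ ∩ Wᶜ)) = prob p (Y ∩ (Aᶜ ∩ Wᶜ ∩ Γ)) + prob p (Y ∩ (Aᶜ ∩ Wᶜ ∩ Γᶜ)) := by
  have := prob_inter_add_prob_inter_compl p (Y ∩ (Aᶜ ∩ Wᶜ)) Γ
  have e1 : Y ∩ (Aᶜ ∩ Wᶜ) ∩ Γ = Y ∩ (Aᶜ ∩ Wᶜ ∩ Γ) := by simp only [Set.inter_assoc]
  have e2 : Y ∩ (Aᶜ ∩ Wᶜ) ∩ Γᶜ = Y ∩ (Aᶜ ∩ Wᶜ ∩ Γᶜ) := by simp only [Set.inter_assoc]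
  rw [e1, e2] at this
  exact this.symm

include Γ in
/-- The `(f₁ open, f₂ open)` cell of `U ∩ e ∩ L`: `P((A ∩ W ∩ X₁) ∪ (A ∩ Wᶜ ∩ X₂) ∪ (Aᶜ ∩ W ∩ X₃))`. -/
lemma prob_mix3 (X₁ X₂ X₃ : Set (Config E)) :
    prob p ((A ∩ W ∩ X₁) ∪ (A ∩ Wᶜ ∩ X₂) ∪ (Aᶜ ∩ W ∩ X₃))
      = prob p (X₁ ∩ (A ∩ W)) + prob p (X₂ ∩ (A ∩ Wᶜ)) + prob p (X₃ ∩ (Aᶜ ∩ W)) := by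
  rw [prob_eq_sum_five p A W Γ ((A ∩ W ∩ X₁) ∪ (A ∩ Wᶜ ∩ X₂) ∪ (Aᶜ ∩ W ∩ X₃))]
  have e1 : (A ∩ W ∩ X₁ ∪ A ∩ Wᶜ ∩ X₂ ∪ Aᶜ ∩ W ∩ X₃) ∩ (A ∩ W) = X₁ ∩ (A ∩ W) := by
    ext ω; simp only [Set.mem_inter_iff, Set.mem_union, Set.mem_compl_iff]; tauto
  have e2 : (A ∩ W ∩ X₁ ∪ A ∩ Wᶜ ∩ X₂ ∪ Aᶜ ∩ W ∩ X₃) ∩ (A ∩ Wᶜ) = X₂ ∩ (A ∩ Wᶜ) := by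
    ext ω; simp only [Set.mem_inter_iff, Set.mem_union, Set.mem_compl_iff]; tauto
  have e3 : (A ∩ W ∩ X₁ ∪ A ∩ Wᶜ ∩ X₂ ∪ Aᶜ ∩ W ∩ X₃) ∩ (Aᶜ ∩ W) = X₃ ∩ (Aᶜ ∩ W) := by
    ext ω; simp only [Set.mem_inter_iff, Set.mem_union, Set.mem_compl_iff]; tauto
  have e4 : (A ∩ W ∩ X₁ ∪ A ∩ Wᶜ ∩ X₂ ∪ Aᶜ ∩ W ∩ X₃) ∩ (Aᶜ ∩ Wᶜ ∩ Γ) = ∅ := by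
    ext ω; simp only [Set.mem_inter_iff, Set.mem_union, Set.mem_compl_iff, Set.mem_empty_iff_false]; tauto
  have e5 : (A ∩ W ∩ X₁ ∪ A ∩ Wᶜ ∩ X₂ ∪ Aᶜ ∩ W ∩ X₃) ∩ (Aᶜ ∩ Wᶜ ∩ Γᶜ) = ∅ := by
    ext ω; simp only [Set.mem_inter_iff, Set.mem_union, Set.mem_compl_iff, Set.mem_empty_iff_false]; tauto
  rw [e1, e2, e3, e4, e5, prob_empty]; ring

/-- The `(f₁ open, f₂ open)` cell of `U`. -/
lemma prob_mix4 (X₀ X₁ X₂ X₃ : Set (Config E)) :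
    prob p ((A ∩ W ∩ X₁) ∪ (A ∩ Wᶜ ∩ X₂) ∪ (Aᶜ ∩ W ∩ X₃) ∪ (Aᶜ ∩ Wᶜ ∩ X₀))
      = prob p (X₁ ∩ (A ∩ W)) + prob p (X₂ ∩ (A ∩ Wᶜ)) + prob p (X₃ ∩ (Aᶜ ∩ W))
        + prob p (X₀ ∩ (Aᶜ ∩ Wᶜ ∩ Γ)) + prob p (X₀ ∩ (Aᶜ ∩ Wᶜ ∩ Γᶜ)) := by
  rw [prob_eq_sum_five p A W Γ ((A ∩ W ∩ X₁) ∪ (A ∩ Wᶜ ∩ X₂) ∪ (Aᶜ ∩ W ∩ X₃) ∪ (Aᶜ ∩ Wᶜ ∩ X₀))]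
  have e1 : (A ∩ W ∩ X₁ ∪ A ∩ Wᶜ ∩ X₂ ∪ Aᶜ ∩ W ∩ X₃ ∪ Aᶜ ∩ Wᶜ ∩ X₀) ∩ (A ∩ W) = X₁ ∩ (A ∩ W) := by
    ext ω; simp only [Set.mem_inter_iff, Set.mem_union, Set.mem_compl_iff]; tauto
  have e2 : (A ∩ W ∩ X₁ ∪ A ∩ Wᶜ ∩ X₂ ∪ Aᶜ ∩ W ∩ X₃ ∪ Aᶜ ∩ Wᶜ ∩ X₀) ∩ (A ∩ Wᶜ) = X₂ ∩ (A ∩ Wᶜ) := by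
    ext ω; simp only [Set.mem_inter_iff, Set.mem_union, Set.mem_compl_iff]; tauto
  have e3 : (A ∩ W ∩ X₁ ∪ A ∩ Wᶜ ∩ X₂ ∪ Aᶜ ∩ W ∩ X₃ ∪ Aᶜ ∩ Wᶜ ∩ X₀) ∩ (Aᶜ ∩ W) = X₃ ∩ (Aᶜ ∩ W) := by
    ext ω; simp only [Set.mem_inter_iff, Set.mem_union, Set.mem_compl_iff]; tauto
  have e4 : (A ∩ W ∩ X₁ ∪ A ∩ Wᶜ ∩ X₂ ∪ Aᶜ ∩ W ∩ X₃ ∪ Aᶜ ∩ Wᶜ ∩ X₀) ∩ (Aᶜ ∩ Wᶜ ∩ Γ)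
      = X₀ ∩ (Aᶜ ∩ Wᶜ ∩ Γ) := by
    ext ω; simp only [Set.mem_inter_iff, Set.mem_union, Set.mem_compl_iff]; tauto
  have e5 : (A ∩ W ∩ X₁ ∪ A ∩ Wᶜ ∩ X₂ ∪ Aᶜ ∩ W ∩ X₃ ∪ Aᶜ ∩ Wᶜ ∩ X₀) ∩ (Aᶜ ∩ Wᶜ ∩ Γᶜ)
      = X₀ ∩ (Aᶜ ∩ Wᶜ ∩ Γᶜ) := by
    ext ω; simp only [Set.mem_inter_iff, Set.mem_union, Set.mem_compl_iff]; tauto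
  rw [e1, e2, e3, e4, e5]

/-- The `(f₁ open, f₂ closed)` cell of `U`: `P((A ∩ X₁) ∪ (Aᶜ ∩ X₀))`. -/
lemma prob_mixA (X₀ X₁ : Set (Config E)) :
    prob p ((A ∩ X₁) ∪ (Aᶜ ∩ X₀)) = prob p (X₁ ∩ (A ∩ W)) + prob p (X₁ ∩ (A ∩ Wᶜ)) + prob p (X₀ ∩ (Aᶜ ∩ W))
      + prob p (X₀ ∩ (Aᶜ ∩ Wᶜ ∩ Γ)) + prob p (X₀ ∩ (Aᶜ ∩ Wᶜ ∩ Γᶜ)) := by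
  rw [prob_eq_sum_five p A W Γ ((A ∩ X₁) ∪ (Aᶜ ∩ X₀))]
  have e1 : (A ∩ X₁ ∪ Aᶜ ∩ X₀) ∩ (A ∩ W) = X₁ ∩ (A ∩ W) := by
    ext ω; simp only [Set.mem_inter_iff, Set.mem_union, Set.mem_compl_iff]; tauto
  have e2 : (A ∩ X₁ ∪ Aᶜ ∩ X₀) ∩ (A ∩ Wᶜ) = X₁ ∩ (A ∩ Wᶜ) := by
    ext ω; simp only [Set.mem_inter_iff, Set.mem_union, Set.mem_compl_iff]; tauto
  have e3 : (A ∩ X₁ ∪ Aᶜ ∩ X₀) ∩ (Aᶜ ∩ W) = X₀ ∩ (Aᶜ ∩ W) := by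
    ext ω; simp only [Set.mem_inter_iff, Set.mem_union, Set.mem_compl_iff]; tauto
  have e4 : (A ∩ X₁ ∪ Aᶜ ∩ X₀) ∩ (Aᶜ ∩ Wᶜ ∩ Γ) = X₀ ∩ (Aᶜ ∩ Wᶜ ∩ Γ) := by
    ext ω; simp only [Set.mem_inter_iff, Set.mem_union, Set.mem_compl_iff]; tauto
  have e5 : (A ∩ X₁ ∪ Aᶜ ∩ X₀) ∩ (Aᶜ ∩ Wᶜ ∩ Γᶜ) = X₀ ∩ (Aᶜ ∩ Wᶜ ∩ Γᶜ) := by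
    ext ω; simp only [Set.mem_inter_iff, Set.mem_union, Set.mem_compl_iff]; tauto
  rw [e1, e2, e3, e4, e5]

end TypeSplitI

section TheoremIAbstract

variable {E : Type*} [Fintype E] [DecidableEq E] {R : Type*} [CommRing R] [LinearOrder R]
  [IsStrictOrderedRing R]

/-- **Theorem I, abstract form** — see the module docstring. -/
theorem zc_oa3w {p : E → R} (hp : IsProbVec p) {f₁ f₂ : E} (hf : f₁ ≠ f₂)
    {A W Γ X₀ X₁ X₂ X₃ X₄ : Set (Config E)}
    (hA : ∀ (ω : Config E) (b₁ b₂ : Bool),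
      Function.update (Function.update ω f₁ b₁) f₂ b₂ ∈ A ↔ ω ∈ A)
    (hW : ∀ (ω : Config E) (b₁ b₂ : Bool),
      Function.update (Function.update ω f₁ b₁) f₂ b₂ ∈ W ↔ ω ∈ W)
    (hΓ : ∀ (ω : Config E) (b₁ b₂ : Bool),
      Function.update (Function.update ω f₁ b₁) f₂ b₂ ∈ Γ ↔ ω ∈ Γ)
    (hX₀ : ∀ (ω : Config E) (b₁ b₂ : Bool),
      Function.update (Function.update ω f₁ b₁) f₂ b₂ ∈ X₀ ↔ ω ∈ X₀)
    (hX₁ : ∀ (ω : Config E) (b₁ b₂ : Bool),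
      Function.update (Function.update ω f₁ b₁) f₂ b₂ ∈ X₁ ↔ ω ∈ X₁)
    (hX₂ : ∀ (ω : Config E) (b₁ b₂ : Bool),
      Function.update (Function.update ω f₁ b₁) f₂ b₂ ∈ X₂ ↔ ω ∈ X₂)
    (hX₃ : ∀ (ω : Config E) (b₁ b₂ : Bool),
      Function.update (Function.update ω f₁ b₁) f₂ b₂ ∈ X₃ ↔ ω ∈ X₃)
    (hAup : IsUpperSet A) (hWup : IsUpperSet W) (hΓup : IsUpperSet Γ)
    (hX₀up : IsUpperSet X₀) (hX₁up : IsUpperSet X₁) (hX₂up : IsUpperSet X₂)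
    (hX₃up : IsUpperSet X₃) (hX₄up : IsUpperSet X₄)
    (hAΓ : ∀ ω, ω ∈ A → ω ∈ Γ → ω ∈ W)
    (h01 : X₀ ⊆ X₁) (h12 : X₁ ⊆ X₂) (h13 : X₁ ⊆ X₃) (h24 : X₂ ⊆ X₄)
    (h3A : X₃ ∩ A = X₁ ∩ A) (h4A : X₄ ∩ A = X₂ ∩ A) (h2W : X₂ ∩ W = X₁ ∩ W)
    (h4W : X₄ ∩ W = X₃ ∩ W) (h2Γ : X₂ ∩ Γ = X₃ ∩ Γ) (h4Γ : X₄ ∩ Γ = X₂ ∩ Γ)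
    (hP1a : prob p (A ∩ Wᶜ) * prob p (Aᶜ ∩ Wᶜ ∩ Γ) ≤ prob p (A ∩ W) * prob p (Aᶜ ∩ Wᶜ ∩ Γᶜ))
    (hNA₀ : prob p (X₀ ∩ (Aᶜ ∩ Wᶜ ∩ Γ)) * prob p Aᶜ ≤ prob p (X₀ ∩ Aᶜ) * prob p (Aᶜ ∩ Wᶜ ∩ Γ))
    (hNA₀' : prob p (X₀ ∩ (Aᶜ ∩ Wᶜ ∩ Γ)) * prob p (Aᶜ ∩ Wᶜ)
      ≤ prob p (X₀ ∩ (Aᶜ ∩ Wᶜ)) * prob p (Aᶜ ∩ Wᶜ ∩ Γ))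
    (hNA₁' : prob p (X₁ ∩ (Aᶜ ∩ Wᶜ ∩ Γ)) * prob p (Aᶜ ∩ Wᶜ)
      ≤ prob p (X₁ ∩ (Aᶜ ∩ Wᶜ)) * prob p (Aᶜ ∩ Wᶜ ∩ Γ))
    (hZC₀ : 0 ≤ prob p (Aᶜ ∩ Wᶜ ∩ Γᶜ) * (prob p (X₀ ∩ (A ∩ W)) - prob p X₀ * prob p (A ∩ W))
      - prob p (Aᶜ ∩ Wᶜ ∩ Γ) * (prob p (X₀ ∩ (A ∩ Wᶜ)) - prob p X₀ * prob p (A ∩ Wᶜ)))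
    (hZC₁ : 0 ≤ prob p (Aᶜ ∩ Wᶜ ∩ Γᶜ) * (prob p (X₁ ∩ (A ∩ W)) - prob p X₁ * prob p (A ∩ W))
      - prob p (Aᶜ ∩ Wᶜ ∩ Γ) * (prob p (X₁ ∩ (A ∩ Wᶜ)) - prob p X₁ * prob p (A ∩ Wᶜ))) :
    let e := A ∪ (openEdge f₁ ∩ openEdge f₂ ∩ W)
    let L := (openEdge f₁ ∩ A) ∪ (openEdge f₂ ∩ W)
    let U := (openEdge f₁ ∩ openEdge f₂ ∩ A ∩ Wᶜ ∩ X₂) ∪ (openEdge f₁ ∩ openEdge f₂ ∩ Aᶜ ∩ W ∩ X₃)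
      ∪ (L ∩ (openEdge f₁ ∩ openEdge f₂ ∩ ((A ∩ Wᶜ) ∪ (Aᶜ ∩ W)))ᶜ ∩ X₁) ∪ (Lᶜ ∩ X₀)
    let γ := openEdge f₁ ∪ (openEdge f₂ ∩ Γ)
    0 ≤ prob p (eᶜ ∩ Lᶜ ∩ γᶜ) * (prob p (U ∩ (e ∩ L)) - prob p U * prob p (e ∩ L))
      - prob p (eᶜ ∩ Lᶜ ∩ γ) * (prob p (U ∩ (e ∩ Lᶜ)) - prob p U * prob p (e ∩ Lᶜ)) := by
  intro e L U γ
  -- the cell expansions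
  have PeL := oa3w_prob_eL p hf hA hW
  have PenL := oa3w_prob_enL p hf hA hW
  have PUeL := oa3w_prob_UeL p hf (X₀ := X₀) hA hW hX₁ hX₂ hX₃
  have PUenL := oa3w_prob_UenL p hf (X₁ := X₁) (X₂ := X₂) (X₃ := X₃) hA hW hX₀
  have PU := oa3w_prob_U p hf hA hW hX₀ hX₁ hX₂ hX₃
  have PB := oa3w_prob_B p hf hA hW hΓ
  have PD := oa3w_prob_D p hf hA hW hΓ
  -- the coincidences in the masses
  have c31 : prob p (X₃ ∩ (A ∩ W)) = prob p (X₁ ∩ (A ∩ W)) := by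
    rw [← Set.inter_assoc, ← Set.inter_assoc, h3A]
  have c32 : prob p (X₃ ∩ (A ∩ Wᶜ)) = prob p (X₁ ∩ (A ∩ Wᶜ)) := by
    rw [← Set.inter_assoc, ← Set.inter_assoc, h3A]
  have c21 : prob p (X₂ ∩ (A ∩ W)) = prob p (X₁ ∩ (A ∩ W)) := by
    rw [← Set.inter_assoc, ← Set.inter_assoc, Set.inter_comm X₂ A, Set.inter_comm X₁ A,
      Set.inter_assoc, Set.inter_assoc, h2W]
  have c23 : prob p (X₂ ∩ (Aᶜ ∩ W)) = prob p (X₁ ∩ (Aᶜ ∩ W)) := by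
    rw [← Set.inter_assoc, ← Set.inter_assoc, Set.inter_comm X₂ Aᶜ, Set.inter_comm X₁ Aᶜ,
      Set.inter_assoc, Set.inter_assoc, h2W]
  have c41 : prob p (X₄ ∩ (A ∩ W)) = prob p (X₁ ∩ (A ∩ W)) := by
    rw [← c21, ← Set.inter_assoc, ← Set.inter_assoc, h4A]
  have c42 : prob p (X₄ ∩ (A ∩ Wᶜ)) = prob p (X₂ ∩ (A ∩ Wᶜ)) := by
    rw [← Set.inter_assoc, ← Set.inter_assoc, h4A]
  have c43 : prob p (X₄ ∩ (Aᶜ ∩ W)) = prob p (X₃ ∩ (Aᶜ ∩ W)) := by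
    rw [← Set.inter_assoc, ← Set.inter_assoc, Set.inter_comm X₄ Aᶜ, Set.inter_comm X₃ Aᶜ,
      Set.inter_assoc, Set.inter_assoc, h4W]
  have c34 : prob p (X₃ ∩ (Aᶜ ∩ Wᶜ ∩ Γ)) = prob p (X₂ ∩ (Aᶜ ∩ Wᶜ ∩ Γ)) := by
    congr 1
    ext ω
    have h := Set.ext_iff.1 h2Γ ω
    simp only [Set.mem_inter_iff, Set.mem_compl_iff] at h ⊢
    tauto
  have c44 : prob p (X₄ ∩ (Aᶜ ∩ Wᶜ ∩ Γ)) = prob p (X₂ ∩ (Aᶜ ∩ Wᶜ ∩ Γ)) := by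
    congr 1
    ext ω
    have h := Set.ext_iff.1 h4Γ ω
    simp only [Set.mem_inter_iff, Set.mem_compl_iff] at h ⊢
    tauto
  -- type probabilities
  have hsum := prob_eq_sum_five p A W Γ Set.univ
  simp only [Set.univ_inter, prob_univ] at hsum
  have PAW := prob_inter_union_AW p (A := A) (W := W) Set.univ
  have PA := prob_inter_A p (A := A) (W := W) Set.univ
  have PAc := prob_inter_Ac p (A := A) (W := W) (Γ := Γ) Set.univ
  have PAcWc := prob_inter_AcWc p (A := A) (W := W) (Γ := Γ) Set.univ
  simp only [Set.univ_inter] at PAW PA PAc PAcWc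
  -- masses of the cluster events
  have MX0 := prob_eq_sum_five p A W Γ X₀
  have MX1 := prob_eq_sum_five p A W Γ X₁
  have MX2 := prob_eq_sum_five p A W Γ X₂
  have MX3 := prob_eq_sum_five p A W Γ X₃
  have MX4 := prob_eq_sum_five p A W Γ X₄
  rw [c21, c23] at MX2
  rw [c31, c32, c34] at MX3
  rw [c41, c42, c43, c44] at MX4
  have MX0A := prob_inter_A p (A := A) (W := W) X₀
  have MX1A := prob_inter_A p (A := A) (W := W) X₁
  have MX0Ac := prob_inter_Ac p (A := A) (W := W) (Γ := Γ) X₀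
  have MX0AcWc := prob_inter_AcWc p (A := A) (W := W) (Γ := Γ) X₀
  have MX1AcWc := prob_inter_AcWc p (A := A) (W := W) (Γ := Γ) X₁
  have MX0WΓ := prob_inter_union_WΓ p hAΓ X₀
  have MX1WΓ := prob_inter_union_WΓ p hAΓ X₁
  have Mmix := prob_mix p (A := A) (W := W) (Γ := Γ) X₀ X₁
  have MmixA := prob_mixA p (A := A) (W := W) (Γ := Γ) X₀ X₁
  have Mmix3 := prob_mix3 p (A := A) (W := W) (Γ := Γ) X₁ X₂ X₃
  have Mmix4 := prob_mix4 p (A := A) (W := W) (Γ := Γ) X₀ X₁ X₂ X₃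
  -- Harris slacks
  have hT1up : IsUpperSet (A ∩ W) := hAup.inter hWup
  have hWΓup : IsUpperSet (W ∪ Γ) := hWup.union hΓup
  have har : ∀ {X S : Set (Config E)}, IsUpperSet X → IsUpperSet S →
      0 ≤ prob p (X ∩ S) - prob p S * prob p X := fun hX hS => by
    rw [mul_comm]; exact sub_nonneg.2 (prob_mul_prob_le_prob_inter hp hX hS)
  have hHar0_1 := har hX₀up hT1up
  have hHar0_134 := har hX₀up hWΓup
  have hHar1_134 := har hX₁up hWΓup
  have hHar2_1 := har hX₂up hT1up
  have hHar3_1 := har hX₃up hT1up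
  have hHar4_1 := har hX₄up hT1up
  have PWΓ := prob_inter_union_WΓ p hAΓ Set.univ
  simp only [Set.univ_inter] at PWΓ
  rw [MX0] at hHar0_1 hHar0_134
  rw [MX0WΓ, PWΓ] at hHar0_134
  rw [MX1, MX1WΓ, PWΓ] at hHar1_134
  rw [MX2, c21] at hHar2_1
  rw [MX3, c31] at hHar3_1
  rw [MX4, c41] at hHar4_1
  -- the BHK-avoidance slacks
  have hNA0raw := sub_nonneg.2 hNA₀
  have hNA0'raw := sub_nonneg.2 hNA₀'
  have hNA1'raw := sub_nonneg.2 hNA₁'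
  rw [MX0Ac, PAc] at hNA0raw
  rw [MX0AcWc, PAcWc] at hNA0'raw
  rw [MX1AcWc, PAcWc] at hNA1'raw
  have hNA0 : 0 ≤ (prob p (X₀ ∩ (Aᶜ ∩ Wᶜ ∩ Γ)) + prob p (X₀ ∩ (Aᶜ ∩ W)) + prob p (X₀ ∩ (Aᶜ ∩ Wᶜ ∩ Γᶜ)))
      * prob p (Aᶜ ∩ Wᶜ ∩ Γ) - prob p (X₀ ∩ (Aᶜ ∩ Wᶜ ∩ Γ))
      * (prob p (Aᶜ ∩ Wᶜ ∩ Γ) + prob p (Aᶜ ∩ W) + prob p (Aᶜ ∩ Wᶜ ∩ Γᶜ)) := by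
    linear_combination hNA0raw
  have hNA0' : 0 ≤ (prob p (X₀ ∩ (Aᶜ ∩ Wᶜ ∩ Γ)) + prob p (X₀ ∩ (Aᶜ ∩ Wᶜ ∩ Γᶜ))) * prob p (Aᶜ ∩ Wᶜ ∩ Γ)
      - prob p (X₀ ∩ (Aᶜ ∩ Wᶜ ∩ Γ)) * (prob p (Aᶜ ∩ Wᶜ ∩ Γ) + prob p (Aᶜ ∩ Wᶜ ∩ Γᶜ)) := by
    linear_combination hNA0'raw
  have hNA1' : 0 ≤ (prob p (X₁ ∩ (Aᶜ ∩ Wᶜ ∩ Γ)) + prob p (X₁ ∩ (Aᶜ ∩ Wᶜ ∩ Γᶜ))) * prob p (Aᶜ ∩ Wᶜ ∩ Γ)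
      - prob p (X₁ ∩ (Aᶜ ∩ Wᶜ ∩ Γ)) * (prob p (Aᶜ ∩ Wᶜ ∩ Γ) + prob p (Aᶜ ∩ Wᶜ ∩ Γᶜ)) := by
    linear_combination hNA1'raw
  -- monotonicity slacks
  have mono : ∀ {X Y : Set (Config E)} (T : Set (Config E)), X ⊆ Y →
      0 ≤ prob p (Y ∩ T) - prob p (X ∩ T) :=
    fun T h => sub_nonneg.2 (prob_mono hp (Set.inter_subset_inter_left _ h))
  have h02 : X₀ ⊆ X₂ := h01.trans h12
  have h03 : X₀ ⊆ X₃ := h01.trans h13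
  have h04 : X₀ ⊆ X₄ := h02.trans h24
  have hm11_m10 := mono (A ∩ W) h01
  have hm21_m20 := mono (A ∩ Wᶜ) h01
  have hm22_m20 := mono (A ∩ Wᶜ) h02
  have hm31_m30 := mono (Aᶜ ∩ W) h01
  have hm33_m30 := mono (Aᶜ ∩ W) h03
  have hm33_m31 := mono (Aᶜ ∩ W) h13
  have hm41_m40 := mono (Aᶜ ∩ Wᶜ ∩ Γ) h01
  have hm42_m40 := mono (Aᶜ ∩ Wᶜ ∩ Γ) h02
  have hm51_m50 := mono (Aᶜ ∩ Wᶜ ∩ Γᶜ) h01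
  have hm52_m50 := mono (Aᶜ ∩ Wᶜ ∩ Γᶜ) h02
  have hm53_m50 := mono (Aᶜ ∩ Wᶜ ∩ Γᶜ) h03
  have hm54_m50 := mono (Aᶜ ∩ Wᶜ ∩ Γᶜ) h04
  -- (P1) and the inductive atoms in the type vocabulary
  have hP1a' := sub_nonneg.2 hP1a
  rw [MX0] at hZC₀
  rw [MX1] at hZC₁
  -- the weights
  have hp0 := hp.nonneg f₁
  have hp1 : 0 ≤ 1 - p f₁ := sub_nonneg.2 (hp.le_one f₁)
  have hq0 := hp.nonneg f₂
  have hq1 : 0 ≤ 1 - p f₂ := sub_nonneg.2 (hp.le_one f₂)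
  have hT1 : 0 ≤ prob p (A ∩ W) := prob_nonneg hp _
  have hT2 : 0 ≤ prob p (A ∩ Wᶜ) := prob_nonneg hp _
  have hT3 : 0 ≤ prob p (Aᶜ ∩ W) := prob_nonneg hp _
  have hT4 : 0 ≤ prob p (Aᶜ ∩ Wᶜ ∩ Γ) := prob_nonneg hp _
  have hT5 : 0 ≤ prob p (Aᶜ ∩ Wᶜ ∩ Γᶜ) := prob_nonneg hp _
  -- rewrite the goal into the masses
  rw [PeL, PUeL, PenL, PUenL, PU, PB, PD, PAW, PA, PAc, PAcWc, MX1A, MX0A, Mmix3, Mmix4, MmixA,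
    Mmix, MX0]
  -- the certificate
  have key := zc_oa3w_cert (p f₁) (p f₂) (prob p (A ∩ W)) (prob p (A ∩ Wᶜ)) (prob p (Aᶜ ∩ W))
    (prob p (Aᶜ ∩ Wᶜ ∩ Γ)) (prob p (Aᶜ ∩ Wᶜ ∩ Γᶜ))
    (prob p (X₀ ∩ (A ∩ W))) (prob p (X₁ ∩ (A ∩ W))) (prob p (X₀ ∩ (A ∩ Wᶜ))) (prob p (X₁ ∩ (A ∩ Wᶜ)))
    (prob p (X₂ ∩ (A ∩ Wᶜ))) (prob p (X₀ ∩ (Aᶜ ∩ W))) (prob p (X₁ ∩ (Aᶜ ∩ W))) (prob p (X₃ ∩ (Aᶜ ∩ W)))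
    (prob p (X₀ ∩ (Aᶜ ∩ Wᶜ ∩ Γ))) (prob p (X₁ ∩ (Aᶜ ∩ Wᶜ ∩ Γ))) (prob p (X₂ ∩ (Aᶜ ∩ Wᶜ ∩ Γ)))
    (prob p (X₀ ∩ (Aᶜ ∩ Wᶜ ∩ Γᶜ))) (prob p (X₁ ∩ (Aᶜ ∩ Wᶜ ∩ Γᶜ))) (prob p (X₂ ∩ (Aᶜ ∩ Wᶜ ∩ Γᶜ)))
    (prob p (X₃ ∩ (Aᶜ ∩ Wᶜ ∩ Γᶜ))) (prob p (X₄ ∩ (Aᶜ ∩ Wᶜ ∩ Γᶜ)))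
    hp0 hp1 hq0 hq1 hT1 hT2 hT3 hT4 hT5 hsum.symm hHar0_1 hHar0_134 hHar1_134 hHar2_1 hHar3_1
    hHar4_1 hNA0 hNA0' hNA1' hP1a' hZC₀ hZC₁ hm11_m10 hm21_m20 hm22_m20 hm31_m30 hm33_m30
    hm33_m31 hm41_m40 hm42_m40 hm51_m50 hm52_m50 hm53_m50 hm54_m50
  refine le_of_le_of_eq key ?_
  ring

end TheoremIAbstract

end Summit.Ventures.PercRepro2
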